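import Summits.AnomalousDissipation.AnomalousDissipation.Theorems.UniformResolution.Negative.Agmon
import Summits.AnomalousDissipation.AnomalousDissipation.Theorems.UniformResolution.Negative.SteadyStates
import Summits.AnomalousDissipation.AnomalousDissipation.Theorems.MomentParityMomentLadderStubWeightedPalinstrophyBound
import Summits.AnomalousDissipation.AnomalousDissipation.Theorems.CubicParityLoud.Negative.EnergyRow
import Summits.AnomalousDissipation.AnomalousDissipation.Theorems.CubicParityLoud.Negative.Clauses
import Literature.Analysis.FunctionSpaces.TorusAgmonLatticeSum
import Literature.Analysis.FluidPDE.ZerothLaw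

/-!
# Stub `stub_stretchingBound` for line `enstrophy-ui-level-ledger`
# (crux `MomentParity.ResolvedDissipation`, stmt-AnomalousDissipation-14284)

The torus Agmon / vortex-stretching bound in bilinear form (stub S1 of the line): there is an absolute
constant `c` such that for every level-`N` field `u ∈ H` (a divergence-free mean-zero vector trigonometric
polynomial) and every smooth field `w` on `𝕋³`,

`|∫ (u ⊗ u) : ∇w| ≤ c ‖∇u‖₂^{3/2} ‖Δu‖₂^{1/2} ‖w‖₂`,

with `∫ (u ⊗ u) : ∇w = Torus.inertialPairing u w`, `‖∇u‖₂² = Torus.eGradNormSq u` (spectral) and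
`‖Δu‖₂² = eLaplacianNormSq u` (spectral).

Proof. (i) Replace `u` by its smooth representative `ū = P_N u` (`coe_ae_eq_trunc`), a real trigonometric
polynomial on the frequency ball with coefficients `û`, `û(0) = 0`; (ii) integrate by parts using `div ū = 0`:
`∫ ⟪(∇w) ū, ū⟫ = −∫ ⟪(ū·∇)ū, w⟫` (`Torus.integral_inner_convect_eq_neg`); (iii) Cauchy–Schwarz;
(iv) `∫ ‖(ū·∇)ū‖² ≤ ‖ū‖_∞² ∫ Σⱼ‖∂ⱼū‖² = ‖ū‖_∞² ‖∇u‖₂²` (`integral_norm_sq_convect_self_le`);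
(v) the SHARP Agmon inequality `‖ū‖_∞ ≤ C₀ ‖∇u‖₂^{1/2} ‖Δu‖₂^{1/2}` (`norm_realTrigPoly_le_sharpAgmon`,
proved here): `‖ū(x)‖ ≤ Σ ‖û k‖`, the weighted Cauchy–Schwarz inequality
`(Σ‖û k‖)² ≤ (Σ_{k≠0} ρ/(μₖ(μₖ+ρ))) · (Σ μₖ‖û k‖² + Σ μₖ²‖û k‖²/ρ)`, `μₖ = 4π²|k|²`, the landed lattice sum
`Σ_{k≠0} ρ/(μₖ(μₖ+ρ)) ≤ C ρ^{1/2}` (`Torus.tsum_agmonWeight_le`) and the choice `ρ = ‖Δu‖₂²/‖∇u‖₂²`.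
References: Foias–Manley–Rosa–Temam 2001, Ch. II App. A (A.29), (A.26); Constantin–Foias 1988, Ch. 4 and Ch. 6.
-/

noncomputable section

-- `Summit.<Summit>.<Problem>`: single-conjunct summit, the duplicate namespace segment is mandated.
set_option linter.dupNamespace false

namespace Summit.AnomalousDissipation.AnomalousDissipation.Theorems.MomentParityResolvedDissipation.StretchingBound

open MeasureTheory Filter Topology
open scoped ENNReal InnerProductSpace RealInnerProductSpace
open Literature.Analysis.FunctionSpaces Literature.Analysis.FluidPDE
open Summit.AnomalousDissipation.AnomalousDissipation.Theses.MomentParity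
open Summit.AnomalousDissipation.AnomalousDissipation.Theorems.CubicParityLoud.Negative (T3 R3 H3 L2T3)
open Summit.AnomalousDissipation.AnomalousDissipation.Theorems.QuarticGate.Negative
  (IsLevel IsBandTest polyGrad IsPolyStationary)
open Summit.AnomalousDissipation.AnomalousDissipation.Theorems.UniformResolution.Negative
  (coef trunc trunc_eq coef_zero isConjSymm_coef isBandTest_trunc coe_ae_eq_trunc
    integral_sum_norm_sq_partialDeriv_trunc toReal_eGradNormSq_trunc
    integral_norm_sq_convect_self_le integral_norm_sq_laplacian_realTrigPoly)

/-! ## Cauchy–Schwarz for pairings -/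

/-- **Cauchy–Schwarz for pairings of `L²` fields on `𝕋³`**: `|∫ ⟪a, w⟫| ≤ √(∫‖a‖²) · √(∫‖w‖²)`. [folklore] -/
theorem abs_integral_inner_le_sqrt_mul_sqrt {a w : T3 → R3} (ha : MemLp a 2 volume)
    (hw : MemLp w 2 volume) :
    |∫ x, ⟪a x, w x⟫_ℝ| ≤ Real.sqrt (∫ x, ‖a x‖ ^ 2) * Real.sqrt (∫ x, ‖w x‖ ^ 2) := by
  -- adapted from `Literature.Analysis.FluidPDE.CheskidovAssemblyTools.abs_integral_inner_le_sqrt_mul_sqrt`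
  have h1 : |∫ x, ⟪a x, w x⟫_ℝ| ≤ ∫ x, ‖a x‖ * ‖w x‖ := by
    rw [← Real.norm_eq_abs]
    refine (norm_integral_le_integral_norm _).trans (integral_mono_of_nonneg
      (ae_of_all _ fun x => norm_nonneg _) (ha.norm.integrable_mul hw.norm)
      (ae_of_all _ fun x => norm_inner_le_norm _ _))
  have h2 := integral_mul_le_Lp_mul_Lq_of_nonneg Real.HolderConjugate.two_two
    (ae_of_all _ fun x => norm_nonneg (a x)) (ae_of_all _ fun x => norm_nonneg (w x))
    (by simpa using ha.norm) (by simpa using hw.norm)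
  refine h1.trans (h2.trans_eq ?_)
  simp only [Real.rpow_two, one_div, Real.sqrt_eq_rpow]

/-! ## The sharp Agmon inequality for mean-free real vector trigonometric polynomials on `𝕋³` -/

/-- The algebra of the Agmon weights: `ρ/(μ(μ+ρ)) · ((μ + μ²/ρ) a) = a` for `μ, ρ > 0`. [folklore] -/
theorem agmonWeight_mul_cancel {μ ρ : ℝ} (hμ : 0 < μ) (hρ : 0 < ρ) (a : ℝ) :
    ρ / (μ * (μ + ρ)) * ((μ + μ ^ 2 / ρ) * a) = a := by
  field_simp
  ring

/-- **Weighted Cauchy–Schwarz behind Agmon's inequality.** For coefficients `c` on a finite frequency set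
`S` with `c 0 = 0` and every `ρ > 0`,
`(Σ_{k∈S} ‖c k‖)² ≤ (Σ_{k∈S, k≠0} ρ/(μₖ(μₖ+ρ))) · (Σ_{k∈S} μₖ‖c k‖² + (Σ_{k∈S} μₖ²‖c k‖²)/ρ)`,
`μₖ = 4π²|k|²` (write `‖c k‖ = (ρ/(μₖ(μₖ+ρ)))^{1/2} · ((μₖ + μₖ²/ρ)‖c k‖²)^{1/2}` for `k ≠ 0`). [folklore] -/
theorem sq_sum_norm_le_agmonWeight_mul (S : Finset (Fin 3 → ℤ))
    {c : (Fin 3 → ℤ) → EuclideanSpace ℂ (Fin 3)} (hc0 : c 0 = 0) {ρ : ℝ} (hρ : 0 < ρ) :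
    (∑ k ∈ S, ‖c k‖) ^ 2 ≤
      (∑ k ∈ S, (if k = 0 then (0 : ℝ) else
        ρ / (4 * Real.pi ^ 2 * Torus.freqNormSq k * (4 * Real.pi ^ 2 * Torus.freqNormSq k + ρ)))) *
      ((4 * Real.pi ^ 2 * ∑ k ∈ S, Torus.freqNormSq k * ‖c k‖ ^ 2) +
        (16 * Real.pi ^ 4 * ∑ k ∈ S, Torus.freqNormSq k ^ 2 * ‖c k‖ ^ 2) / ρ) := by
  have hsumb : (4 * Real.pi ^ 2 * ∑ k ∈ S, Torus.freqNormSq k * ‖c k‖ ^ 2) +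
        (16 * Real.pi ^ 4 * ∑ k ∈ S, Torus.freqNormSq k ^ 2 * ‖c k‖ ^ 2) / ρ =
      ∑ k ∈ S, (4 * Real.pi ^ 2 * Torus.freqNormSq k +
        (4 * Real.pi ^ 2 * Torus.freqNormSq k) ^ 2 / ρ) * ‖c k‖ ^ 2 := by
    rw [Finset.mul_sum, Finset.mul_sum, Finset.sum_div, ← Finset.sum_add_distrib]
    refine Finset.sum_congr rfl fun k _ => ?_
    ring
  rw [hsumb]
  refine Finset.sum_sq_le_sum_mul_sum_of_sq_le_mul S (fun k _ => ?_) (fun k _ => ?_) (fun k _ => ?_)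
  · have := Torus.freqNormSq_nonneg k
    split_ifs
    · exact le_rfl
    · positivity
  · have := Torus.freqNormSq_nonneg k
    positivity
  · by_cases hk : k = 0
    · subst hk
      simp [hc0]
    · rw [if_neg hk]
      have hμ : 0 < 4 * Real.pi ^ 2 * Torus.freqNormSq k := by
        have := Torus.one_le_freqNormSq hk
        positivity
      exact (agmonWeight_mul_cancel hμ hρ _).ge

/-- **Sharp Agmon inequality for mean-free real vector trigonometric polynomials on `𝕋³`.** There is an
absolute constant `C₀ ≥ 0` such that for every finite frequency set `S`, all coefficients `c` with `c 0 = 0`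
and all `x`, with `p = realTrigPoly S c`,
`‖p(x)‖ ≤ C₀ · (4π² Σ_{k∈S} |k|²‖c k‖²)^{1/4} · (16π⁴ Σ_{k∈S} |k|⁴‖c k‖²)^{1/4}`,
i.e. `‖p‖_∞ ≤ C₀ ‖∇p‖₂^{1/2} ‖Δp‖₂^{1/2}` for conjugate-symmetric `c` on a symmetric `S`
(`‖p(x)‖ ≤ Σ‖c k‖`, `sq_sum_norm_le_agmonWeight_mul`, the lattice sum `Torus.tsum_agmonWeight_le` and
`ρ = ‖Δp‖₂²/‖∇p‖₂²`; `C₀ = (2C)^{1/2}` with the lattice-sum constant `C`).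
[cite: FMRTTurbulence2001, Ch. II App. A (A.29)] -/
theorem norm_realTrigPoly_le_sharpAgmon :
    ∃ C₀ : ℝ, 0 ≤ C₀ ∧ ∀ (S : Finset (Fin 3 → ℤ)) (c : (Fin 3 → ℤ) → EuclideanSpace ℂ (Fin 3)),
      c 0 = 0 → ∀ x : T3, ‖Torus.realTrigPoly S c x‖ ≤
        C₀ * (4 * Real.pi ^ 2 * ∑ k ∈ S, Torus.freqNormSq k * ‖c k‖ ^ 2) ^ (1 / 4 : ℝ) *
          (16 * Real.pi ^ 4 * ∑ k ∈ S, Torus.freqNormSq k ^ 2 * ‖c k‖ ^ 2) ^ (1 / 4 : ℝ) := by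
  obtain ⟨C, hC0, hC⟩ := Torus.tsum_agmonWeight_le (d := Fin 3) (Fintype.card_fin 3)
  refine ⟨Real.sqrt (2 * C), Real.sqrt_nonneg _, fun S c hc0 x => ?_⟩
  have hsum0 : 0 ≤ ∑ k ∈ S, Torus.freqNormSq k * ‖c k‖ ^ 2 :=
    Finset.sum_nonneg fun k _ => mul_nonneg (Torus.freqNormSq_nonneg _) (sq_nonneg _)
  refine (Torus.norm_realTrigPoly_apply_le S c x).trans ?_
  set Z : ℝ := 4 * Real.pi ^ 2 * ∑ k ∈ S, Torus.freqNormSq k * ‖c k‖ ^ 2 with hZdef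
  set P : ℝ := 16 * Real.pi ^ 4 * ∑ k ∈ S, Torus.freqNormSq k ^ 2 * ‖c k‖ ^ 2 with hPdef
  set A : ℝ := ∑ k ∈ S, ‖c k‖ with hAdef
  have hZ0 : 0 ≤ Z := by positivity
  have hP0 : 0 ≤ P := by positivity
  -- termwise `4π²|k|²‖c k‖² ≤ 16π⁴|k|⁴‖c k‖²`, so `Z ≤ P`
  have hZP : Z ≤ P := by
    rw [hZdef, hPdef, Finset.mul_sum, Finset.mul_sum]
    refine Finset.sum_le_sum fun k _ => ?_
    by_cases hk : k = 0
    · subst hk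
      simp [Torus.freqNormSq_zero]
    · have h1 := Torus.one_le_freqNormSq hk
      have hπ : 1 ≤ Real.pi ^ 2 := by nlinarith [Real.pi_gt_three]
      have hc2 : 0 ≤ ‖c k‖ ^ 2 := sq_nonneg _
      have h4 : 1 ≤ 4 * Real.pi ^ 2 * Torus.freqNormSq k := by nlinarith
      have hq : 4 * Real.pi ^ 2 * Torus.freqNormSq k ≤ 16 * Real.pi ^ 4 * Torus.freqNormSq k ^ 2 := by
        rw [show 16 * Real.pi ^ 4 * Torus.freqNormSq k ^ 2 =
          (4 * Real.pi ^ 2 * Torus.freqNormSq k) * (4 * Real.pi ^ 2 * Torus.freqNormSq k) by ring]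
        exact le_mul_of_one_le_right (by positivity) h4
      nlinarith [mul_le_mul_of_nonneg_right hq hc2]
  rcases hZ0.eq_or_lt with hZ | hZpos
  · -- degenerate case: `Z = 0` forces every coefficient to vanish
    have hA : A = 0 := by
      have hsum : ∑ k ∈ S, Torus.freqNormSq k * ‖c k‖ ^ 2 = 0 := by
        have hπ : (0 : ℝ) < 4 * Real.pi ^ 2 := by positivity
        rcases mul_eq_zero.1 hZ.symm with h | h
        · exact absurd h hπ.ne'
        · exact h
      have hterm := (Finset.sum_eq_zero_iff_of_nonneg fun k _ =>
        mul_nonneg (Torus.freqNormSq_nonneg k) (sq_nonneg (‖c k‖))).1 hsum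
      refine Finset.sum_eq_zero fun k hk => ?_
      by_cases h0 : k = 0
      · rw [h0, hc0, norm_zero]
      · have hq : 0 < Torus.freqNormSq k := lt_of_lt_of_le one_pos (Torus.one_le_freqNormSq h0)
        rcases mul_eq_zero.1 (hterm k hk) with h | h
        · exact absurd h hq.ne'
        · exact (pow_eq_zero_iff two_ne_zero).1 h
    rw [hA]
    positivity
  · have hPpos : 0 < P := hZpos.trans_le hZP
    -- quarter powers `e = Z^{1/4}`, `l = P^{1/4}`
    set e : ℝ := Z ^ (1 / 4 : ℝ) with he
    set l : ℝ := P ^ (1 / 4 : ℝ) with hl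
    have he0 : 0 < e := Real.rpow_pos_of_pos hZpos _
    have hl0 : 0 < l := Real.rpow_pos_of_pos hPpos _
    have he4 : Z = e ^ 4 := by
      rw [he, ← Real.rpow_natCast, ← Real.rpow_mul hZ0]; norm_num
    have hl4 : P = l ^ 4 := by
      rw [hl, ← Real.rpow_natCast, ← Real.rpow_mul hP0]; norm_num
    -- the weighted Cauchy–Schwarz at the cut `ρ = P/Z = l⁴/e⁴`
    set ρ : ℝ := l ^ 4 / e ^ 4 with hρdef
    have hρ : 0 < ρ := by positivity
    have hρhalf : ρ ^ (1 / 2 : ℝ) = l ^ 2 / e ^ 2 := by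
      rw [← Real.sqrt_eq_rpow, hρdef, show l ^ 4 / e ^ 4 = (l ^ 2 / e ^ 2) ^ 2 by ring,
        Real.sqrt_sq (by positivity)]
    have hw : A ^ 2 ≤ (∑ k ∈ S, (if k = 0 then (0 : ℝ) else
        ρ / (4 * Real.pi ^ 2 * Torus.freqNormSq k * (4 * Real.pi ^ 2 * Torus.freqNormSq k + ρ)))) *
        (Z + P / ρ) := sq_sum_norm_le_agmonWeight_mul S hc0 hρ
    have hlat : (∑ k ∈ S, (if k = 0 then (0 : ℝ) else
        ρ / (4 * Real.pi ^ 2 * Torus.freqNormSq k * (4 * Real.pi ^ 2 * Torus.freqNormSq k + ρ)))) ≤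
        C * ρ ^ (1 / 2 : ℝ) := by
      refine le_trans ?_ (hC ρ hρ)
      refine Summable.sum_le_tsum S (fun k _ => ?_) (Torus.summable_agmonWeight (by simp) hρ)
      have := Torus.freqNormSq_nonneg k
      split_ifs
      · exact le_rfl
      · positivity
    have hA2 : A ^ 2 ≤ (Real.sqrt (2 * C) * e * l) ^ 2 := by
      calc A ^ 2 ≤ _ := hw
        _ ≤ C * ρ ^ (1 / 2 : ℝ) * (Z + P / ρ) := mul_le_mul_of_nonneg_right hlat (by positivity)
        _ = (Real.sqrt (2 * C) * e * l) ^ 2 := by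
            rw [hρhalf, he4, hl4, mul_pow, mul_pow, Real.sq_sqrt (by positivity), hρdef]
            field_simp
            ring
    have hA0 : 0 ≤ A := Finset.sum_nonneg fun k _ => norm_nonneg _
    exact (pow_le_pow_iff_left₀ hA0 (by positivity) two_ne_zero).1 hA2

/-! ## The inertial pairing and the norms of a level-`N` field through its truncation `ū = P_N u` -/

/-- **The inertial pairing of a level-`N` field, integrated by parts**: for `u ∈ H` of level `N` and smooth
`w`, `∫ (u ⊗ u) : ∇w = −∫ ⟪(ū·∇)ū, w⟫` with `ū = P_N u` the smooth representative of `u`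
(`u = ū` a.e.; `div ū = 0`; `b(ū, ū, w) = −b(ū, w, ū)`). [folklore] -/
theorem inertialPairing_eq_neg_integral_convect_trunc {N : ℕ} {u : H3} (hu : IsLevel N u) {w : T3 → R3}
    (hw : Torus.IsSmooth w) :
    Torus.inertialPairing u.1 w = -∫ x, ⟪Torus.convect (trunc N u) (trunc N u) x, w x⟫_ℝ := by
  have hS : Torus.IsSmooth (trunc N u) := Torus.isSmooth_fourierTruncate _ _
  have hdiv : Torus.IsDivFree (trunc N u) := (isBandTest_trunc u).2.1
  have h1 : Torus.inertialPairing u.1 w = ∫ x, ⟪trunc N u x, Torus.convect (trunc N u) w x⟫_ℝ := by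
    unfold Torus.inertialPairing Torus.convect
    refine integral_congr_ae ?_
    filter_upwards [coe_ae_eq_trunc u hu] with x hx
    rw [hx, real_inner_comm]
  rw [h1, Torus.integral_inner_convect_eq_neg hS hdiv hS hw, neg_neg]

/-- On a level-`N` field the spectral enstrophy, in real form, is `4π² Σ_{|k| ≤ N} |k|² ‖û k‖²`. [folklore] -/
theorem toReal_eGradNormSq_of_isLevel {N : ℕ} {u : H3} (hu : IsLevel N u) :
    (Torus.eGradNormSq (u.1 : T3 → R3)).toReal =
      4 * Real.pi ^ 2 * ∑ k ∈ Torus.freqBall N, Torus.freqNormSq k * ‖coef u k‖ ^ 2 := by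
  rw [← CubicParityLoud.Negative.eGradNormSq_fourierTruncate_of_isLevel hu]
  exact toReal_eGradNormSq_trunc u

/-- On a level-`N` field the spectral palinstrophy, in real form, is `16π⁴ Σ_{|k| ≤ N} |k|⁴ ‖û k‖²`. [folklore] -/
theorem toReal_eLaplacianNormSq_of_isLevel {N : ℕ} {u : H3} (hu : IsLevel N u) :
    (eLaplacianNormSq (u.1 : T3 → R3)).toReal =
      16 * Real.pi ^ 4 * ∑ k ∈ Torus.freqBall N, Torus.freqNormSq k ^ 2 * ‖coef u k‖ ^ 2 := by
  rw [MomentLadder.eLaplacianNormSq_eq_ofReal_of_isLevel hu,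
    ENNReal.toReal_ofReal (integral_nonneg fun _ => sq_nonneg _)]
  exact integral_norm_sq_laplacian_realTrigPoly Torus.neg_mem_freqBall_of_mem (isConjSymm_coef u)

/-! ## The stub -/

/-- **S1 · `stub_stretchingBound` (torus Agmon / vortex-stretching bound).** There is an absolute constant
`c` such that for every level-`N` field `u ∈ H` (a divergence-free mean-zero vector trigonometric polynomial)
and every smooth field `w`, `|∫ (u ⊗ u) : ∇w| ≤ c ‖∇u‖₂^{3/2} ‖Δu‖₂^{1/2} ‖w‖₂`: replace `u` by
`ū = P_N u`, integrate by parts (`div ū = 0`), Cauchy–Schwarz, `∫‖(ū·∇)ū‖² ≤ ‖ū‖_∞² ‖∇u‖₂²` and the sharp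
Agmon inequality `‖ū‖_∞ ≤ C₀ ‖∇u‖₂^{1/2} ‖Δu‖₂^{1/2}` (`norm_realTrigPoly_le_sharpAgmon`); `c = C₀`.
[cite: FMRTTurbulence2001, Ch. II App. A (A.26), (A.29)] -/
theorem stub_stretchingBound :
    ∃ c : ℝ, 0 ≤ c ∧ ∀ (N : ℕ) (u : H3), IsLevel N u → ∀ w : T3 → R3, Torus.IsSmooth w →
      |Torus.inertialPairing u.1 w| ≤
        c * (Torus.eGradNormSq (u.1 : T3 → R3)).toReal ^ (3 / 4 : ℝ) *
          (eLaplacianNormSq (u.1 : T3 → R3)).toReal ^ (1 / 4 : ℝ) *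
            (∫ x, ‖w x‖ ^ 2) ^ (1 / 2 : ℝ) := by
  obtain ⟨C₀, hC₀, hAg⟩ := norm_realTrigPoly_le_sharpAgmon
  refine ⟨C₀, hC₀, fun N u hu w hw => ?_⟩
  have hZ := toReal_eGradNormSq_of_isLevel hu
  have hP := toReal_eLaplacianNormSq_of_isLevel hu
  have hIP := inertialPairing_eq_neg_integral_convect_trunc hu hw
  set p : T3 → R3 := trunc N u with hp
  have hS : Torus.IsSmooth p := Torus.isSmooth_fourierTruncate _ _
  set Z : ℝ := (Torus.eGradNormSq (u.1 : T3 → R3)).toReal with hZdef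
  set P : ℝ := (eLaplacianNormSq (u.1 : T3 → R3)).toReal with hPdef
  set W : ℝ := ∫ x, ‖w x‖ ^ 2 with hWdef
  have hZ0 : 0 ≤ Z := ENNReal.toReal_nonneg
  have hP0 : 0 ≤ P := ENNReal.toReal_nonneg
  -- quarter powers `e = Z^{1/4}`, `l = P^{1/4}`
  set e : ℝ := Z ^ (1 / 4 : ℝ) with he
  set l : ℝ := P ^ (1 / 4 : ℝ) with hl
  have he0 : 0 ≤ e := Real.rpow_nonneg hZ0 _
  have hl0 : 0 ≤ l := Real.rpow_nonneg hP0 _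
  have he3 : Z ^ (3 / 4 : ℝ) = e ^ 3 := by
    rw [he, ← Real.rpow_natCast, ← Real.rpow_mul hZ0]; norm_num
  have he4 : Z = e ^ 4 := by
    rw [he, ← Real.rpow_natCast, ← Real.rpow_mul hZ0]; norm_num
  have hW12 : W ^ (1 / 2 : ℝ) = Real.sqrt W := (Real.sqrt_eq_rpow W).symm
  -- the sup bound `‖ū x‖ ≤ C₀ e l`
  have hsup : ∀ x, ‖p x‖ ≤ C₀ * e * l := fun x => by
    have h := hAg (Torus.freqBall N) (coef u) (coef_zero u) x
    rw [← hZ, ← hP] at h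
    exact h
  -- `∫ ‖(ū·∇)ū‖² ≤ (C₀ e l)² Z`
  have hconv : ∫ x, ‖Torus.convect p p x‖ ^ 2 ≤ (C₀ * e * l) ^ 2 * Z := by
    have h := integral_norm_sq_convect_self_le hS hsup
    rwa [hp, integral_sum_norm_sq_partialDeriv_trunc u, ← hZ] at h
  calc |Torus.inertialPairing u.1 w| ≤ Real.sqrt (∫ x, ‖Torus.convect p p x‖ ^ 2) * Real.sqrt W := by
        rw [hIP, abs_neg]
        exact abs_integral_inner_le_sqrt_mul_sqrt ((hS.convect hS).memLp 2) (hw.memLp 2)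
    _ ≤ Real.sqrt ((C₀ * e * l) ^ 2 * Z) * Real.sqrt W := by gcongr
    _ = C₀ * e ^ 3 * l * Real.sqrt W := by
        rw [he4, show (C₀ * e * l) ^ 2 * e ^ 4 = (C₀ * e ^ 3 * l) ^ 2 by ring,
          Real.sqrt_sq (by positivity)]
    _ = C₀ * Z ^ (3 / 4 : ℝ) * l * W ^ (1 / 2 : ℝ) := by rw [he3, hW12]

end Summit.AnomalousDissipation.AnomalousDissipation.Theorems.MomentParityResolvedDissipation.StretchingBound

end
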